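import Summits.BirchSwinnertonDyer.Rank1Residual.X2.LambdaMinimal
import Summits.BirchSwinnertonDyer.Rank1Residual.X1.TamagawaSqueeze
import Literature.NumberTheory.EllipticCurves.Greenberg1999.SelmerCorankLambdaParity
import Literature.NumberTheory.EllipticCurves.BSDRankResidualCellsProofs
import HarnessLib

/-!
# Class X2 (odd multiplicative Eisenstein prime): ROUTE T at `p ‖ N` — the squeeze with an
# ALGEBRAIC λ LOWER BOUND: `μ_an = 0 ∧ λ_an = n ∧ λ_alg ≥ n − e (− 1 with parity)` ⇒ Mazur's main
# conjecture at `(E,p)` (cell `b2b-bsdres`, unit `b2b-bsdres-eisenstein-p2`, gen 6)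

HONEST FRAMING (run/shared/lean/b2b/bsd-rank1-residual/, verbatim in every file): the goal of the
cell is to DELETE the COMBINATION-SHAPED residual classes of the Birch–Swinnerton-Dyer formula for
ALL analytic-rank `≤ 1` elliptic curves over `ℚ` — "full BSD formula for every rank `≤ 1` curve in
class `C`" assembled STRICTLY from published theorems — so that the rank-`≤ 1` remainder becomes
exactly the CONSTRUCTION-SHAPED classes, which are TYPED (missing-input `Prop`s), NOT attempted.
This is not "finishing BSD". Research routes; NO CLAIM BEYOND STATED CLASSES; nothing here changes
a label; X2b and X2c stay CONSTRUCTION-SHAPED. Theorems only (no definition, no named fact): the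
published theorems enter as the tree's existing NAMED FACTS, taken as hypotheses, and the per-pair
data are the cell's TYPED inputs `X2.AnalyticMuLE` / `X2.AnalyticLambdaEq` (gen 4) and
`X1.TamagawaSqueeze.AlgebraicLambdaGE` (sub-cell `eisenstein-p1` gen 6, p207450 — class-agnostic:
"`λ(X(E/ℚ_∞)) ≥ k` for every cyclotomic Pontryagin-dual datum").

WHY THIS FILE. Routes P (`X2/ParitySqueeze.lean`, λ-excess `2`) and lamMin (`X2/LambdaMinimal.lean`,
λ-excess `0`) close Mazur's main conjecture at a multiplicative Eisenstein pair from the analytic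
invariants alone; at λ-excess `≥ 4` (52 of the 705 X2c census pairs, `N < 2·10⁴`, and the rank-`0`
pairs with `λ_an ≥ 4 + e`) "parity + the `T = 0` valuation cannot pin `λ(f_E)`". Route T of
sub-cell `eisenstein-p1` (X1R0-GAPMAP §14, `X1/TamagawaSqueeze.lean`) isolates the one missing
ingredient — a LOWER bound `λ_alg = λ(X(E/ℚ_∞)) ≥ k` — and this file transposes it to `p ‖ N`:
with Wuthrich's integral divisibility `ϖ·L = ι(T^e·h·f_E)` (`char_Λ X = (f_E)`, Doc. Math. 19
(2014) Thm. 16, multiplicative clauses; `e = 1` at a split prime — the trivial zero —, `e = 0` at a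
non-split prime), `λ(T^e·h·f_E) = e + λ(h) + λ(f_E) = λ_an = n` and `λ(f_E) ≥ k ≥ n − e` force
`λ(h) = 0`; `μ(h) ≤ μ_an = 0`; so `h ∈ Λˣ`. With Greenberg's Prop. 3.10 (`λ(f_E) ≡ corank
Sel_{p^∞}(E/ℚ) = r_an (mod 2)`, the corank by Gross–Zagier–Kolyvagin at `r_an ≤ 1`) and the parity
of the datum `n` (`n ≡ r_an + e (mod 2)`, which the Mazur–Tate–Teitelbaum functional equation at
`p ‖ N` predicts and the census observes), the weaker bound `k ≥ n − e − 1` suffices. NO RANK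
HYPOTHESIS is needed for the parity-free form (the lower bound replaces Jones' `T^{rank} ∣ f_E`).

THE SOURCE OF THE BOUND at `p ‖ N` (OUTSIDE the kernel, exactly as for X1; recipe for the census
`HOME/b2b-bsdres-eisenstein-p2/routeT/`): Greenberg's Cor. 5.6 mechanism over the layers `ℚ_m`
(LNM 1716: control diagram Lemma 3.1–3.2, `|ker r_ℓ| = c_ℓ^{(p)}` at bad `ℓ ≠ p` (remark after
Lemma 3.3), Cassels–Poitou–Tate Prop. 4.13, no finite `Λ`-submodules for `F = ℚ`, `p` odd, good
ordinary OR MULTIPLICATIVE reduction (p. 161), generator inequality p. 137) gives, at a member with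
`μ(X) = μ`, `λ_alg + p^m μ ≥ t_m(E) + a(E) − 2δ(E)` with `t_m = Σ_{ℓ ≠ p bad, p ∣ c_ℓ} min(s_ℓ, p^m)`,
`δ = [p ∣ #E(ℚ)_tors]`, and — the ONLY change at `p ‖ N`, eisenstein-p1's "replace Lemma 3.4 by
Prop. 3.6 (Tate curve at p)" — the local kernel at `𝔭 ∣ p` is read off Greenberg's discussion
after Prop. 3.6 (pp. 91–93 of the volume): at a SPLIT multiplicative `p` it is cyclic of order
`∼ log_p(q_E)/(2p)` (constant in the tower), so `a = 1` iff `ord_p log_p q_E ≥ 2` and `a = 0`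
otherwise; at a NON-split multiplicative odd `p`, `ker(r_{v_n}) = 0`, `a = 0`. Nothing of this
recipe is asserted here: `AlgebraicLambdaGE` is a TYPED input.

* `isUnit_of_lam_mul_mul_eq_of_ge` / `…_of_even` — the squeeze in `Λ` (pure algebra).
* `mazurMainConjectureAt_of_algebraicLambdaGE` — NO parity, NO rank hypothesis:
  `μ_an = 0`, `λ_an = n`, `λ_alg ≥ k`, `n ≤ k + e` ⇒ `X2.MazurMainConjectureAt W p`.
* `mazurMainConjectureAt_of_algebraicLambdaGE_of_parity` — `r_an ≤ 1`, `n ≤ k + e + 1`,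
  `n ≡ r_an + e (mod 2)` (Prop. 3.10 `h310`, GZK `hGZK`).
* `add_le_of_algebraicLambdaGE_of_analyticLambdaEq` — consistency (Kato–Wuthrich direction):
  a certified bound never exceeds `λ_an − e` (the census's falsification test, in the kernel).
* rank-`0` `BSD(E,p)` and the sub-cell forms (X2b typed input; CYCLOTOMIC main-conjecture instances
  at rank-one X2c pairs) are in the companion file `X2/TamagawaSqueezeForms.lean`.

References: [GreenbergLNM1716] Lemma 3.1–3.3 and remark, Prop. 3.6 and pp. 91–93, Prop. 3.10,
Prop. 4.13, p. 137, p. 161, Cor. 5.6 (p. 136); [Wuthrich2014] Thm. 16, §5 (p. 397);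
[GreenbergVatsal2000] (1)–(2), p. 4; HOME/b2b-bsdres-eisenstein-p2/X2-GAP.md §11;
HOME/b2b-bsdres-eisenstein-p1/X1R0-GAPMAP.md §14.
-/

set_option autoImplicit false

noncomputable section

open scoped Classical MatrixGroups ModularForm

open PowerSeries CongruenceSubgroup WeierstrassCurve Literature.NumberTheory.EllipticCurves
  Literature.NumberTheory.EllipticCurves.ModularForms
  Literature.NumberTheory.EllipticCurves.Rank1Residual
  Literature.NumberTheory.EllipticCurves.Rank1Residual.Typed
  Literature.NumberTheory.EllipticCurves.Wuthrich2014
  Literature.NumberTheory.EllipticCurves.SteinWuthrich2013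
  Literature.NumberTheory.EllipticCurves.Greenberg1999
  Summit.BirchSwinnertonDyer.Rank1Residual.X1.MuLambda
  Summit.BirchSwinnertonDyer.Rank1Residual.X1.MuPart
  Summit.BirchSwinnertonDyer.Rank1Residual.X1.ParitySqueeze
  Summit.BirchSwinnertonDyer.Rank1Residual.X1.TamagawaSqueeze

namespace Summit.BirchSwinnertonDyer.Rank1Residual.X2

/-! ## §1. Algebra: the squeeze against a lower bound -/

section Algebra

variable {p : ℕ} [Fact p.Prime]

/-- **The squeeze against a lower bound (pure algebra).** `u, h, f ∈ Λ` nonzero, `λ(u) = e`,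
`μ(u·h·f) = 0`, `λ(u·h·f) = n`, `k ≤ λ(f)` and `n ≤ k + e` ⇒ `h ∈ Λˣ` (and `λ(f) = k = n − e`):
`n = e + λ(h) + λ(f) ≥ e + λ(h) + k ≥ n + λ(h)`. [cite: GreenbergVatsal2000, p. 4 (after Thm. (1.2))] -/
theorem isUnit_of_lam_mul_mul_eq_of_ge {u h f : IwasawaAlgebra p} {e n k : ℕ} (hu : u ≠ 0)
    (hh : h ≠ 0) (hf : f ≠ 0) (hlu : lam u = e) (hμ : mu (u * (h * f)) = 0)
    (hl : lam (u * (h * f)) = n) (hk : k ≤ lam f) (hnk : n ≤ k + e) :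
    IsUnit h ∧ lam f = k ∧ mu f = 0 := by
  obtain ⟨-, hμh, hμf⟩ := mu_eq_zero_of_mu_mul_mul_eq_zero hu hh hf hμ
  rw [lam_mul hu (mul_ne_zero hh hf), lam_mul hh hf, hlu] at hl
  have hlf : lam f = k := by omega
  have hlh : lam h = 0 := by omega
  exact ⟨(isUnit_iff_mu_eq_zero_and_lam_eq_zero h).mpr ⟨hh, hμh, hlh⟩, hlf, hμf⟩

/-- **The squeeze against a lower bound, with parity (pure algebra).** As
`isUnit_of_lam_mul_mul_eq_of_ge` but with `n ≤ k + e + 1` and `n + e + λ(f)` even (so that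
`λ(h) = n − e − λ(f) ≤ 1` is even, hence `0`). [cite: GreenbergLNM1716, §5 p. 183 (Conductor = 147, p = 13)] -/
theorem isUnit_of_lam_mul_mul_eq_of_ge_of_even {u h f : IwasawaAlgebra p} {e n k : ℕ} (hu : u ≠ 0)
    (hh : h ≠ 0) (hf : f ≠ 0) (hlu : lam u = e) (hμ : mu (u * (h * f)) = 0)
    (hl : lam (u * (h * f)) = n) (hk : k ≤ lam f) (hnk : n ≤ k + e + 1)
    (hpar : Even (n + e + lam f)) : IsUnit h ∧ mu f = 0 := by
  obtain ⟨-, hμh, hμf⟩ := mu_eq_zero_of_mu_mul_mul_eq_zero hu hh hf hμ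
  rw [lam_mul hu (mul_ne_zero hh hf), lam_mul hh hf, hlu] at hl
  obtain ⟨j, hj⟩ := hpar
  have hlh : lam h = 0 := by omega
  exact ⟨(isUnit_iff_mu_eq_zero_and_lam_eq_zero h).mpr ⟨hh, hμh, hlh⟩, hμf⟩

end Algebra

/-! ## §2. Route T at `p ‖ N`: Mazur's main conjecture from `μ_an = 0`, `λ_an = n`, `λ_alg ≥ k` -/

section RouteT

variable {W : WeierstrassCurve ℚ} [W.IsElliptic] [W.IsGloballyMinimal] {p : ℕ} [Fact p.Prime]

/-- **Route T at an odd multiplicative Eisenstein prime (no parity, no rank hypothesis).** Data: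
`W/ℚ` globally minimal elliptic, `p ≠ 2` of multiplicative reduction, `E[p]` reducible. PUBLISHED
named fact (hypothesis): Wuthrich 2014 Thm. 16 (`hWu`: `X` torsion, `ϖ·L = ι(T^e·g)`,
`g ∈ char_Λ X`). Per-pair TYPED data: `AnalyticMuLE W p 0` (`μ_an = 0`), `AnalyticLambdaEq W p n`
(`λ_an = n`, trivial zero included), `AlgebraicLambdaGE W p k` (`λ(X(E/ℚ_∞)) ≥ k`), with `n ≤ k` at a
non-split prime and `n ≤ k + 1` at a split prime. Conclusion: `X2.MazurMainConjectureAt W p`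
(`char X = (f_E)`, `g = h·f_E`, `e + λ(h) + λ(f_E) = n ≤ k + e ≤ λ(f_E) + e`, so `λ(h) = 0`;
`μ(h) = 0`; `h ∈ Λˣ`). [cite: Wuthrich2014, Thm. 16 and §5 (p. 397)]
[cite: GreenbergLNM1716, Cor. 5.6 (proof, p. 136) and pp. 91–93 (ker r_v at multiplicative v ∣ p)]
[cite: GreenbergVatsal2000, p. 4 (after Thm. (1.2))] -/
theorem mazurMainConjectureAt_of_algebraicLambdaGE
    (hWu : thm16_charIdeal_dvd_multiplicative_of_reducible)
    (W : WeierstrassCurve ℚ) [W.IsElliptic] [W.IsGloballyMinimal] (p : ℕ) [Fact p.Prime]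
    (hp2 : p ≠ 2) (hmult : W.HasMultiplicativeReductionAtPrime p)
    (hred : ¬ W.HasIrreducibleModPGaloisRep p) {n k : ℕ}
    (hμ0 : AnalyticMuLE W p 0) (hlam : AnalyticLambdaEq W p n) (halg : AlgebraicLambdaGE W p k)
    (hkN : ¬ W.HasSplitMultiplicativeReductionAtPrime p → n ≤ k)
    (hkS : W.HasSplitMultiplicativeReductionAtPrime p → n ≤ k + 1) :
    X2.MazurMainConjectureAt W p := by
  intro κ γ hκ hγ hγ' N _ f hf D ϖ hϖ
  haveI : Module.Finite (IwasawaAlgebra p) D.X := D.module_finite_holds hγ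
  -- Wuthrich Thm. 16 at this datum; a generator `fE` of the characteristic ideal
  obtain ⟨hX, hKns, hKs⟩ := hWu W p hp2 hmult hred hκ hγ hγ' hf D ϖ hϖ
  haveI : (Literature.NumberTheory.EllipticCurves.Module.charIdeal (IwasawaAlgebra p) D.X).IsPrincipal :=
    charIdeal_isPrincipal_holds p D.X
  obtain ⟨fE, hfE⟩ := Submodule.IsPrincipal.principal
    (Literature.NumberTheory.EllipticCurves.Module.charIdeal (IwasawaAlgebra p) D.X)
  have hchar : D.charIdeal = Ideal.span {fE} := hfE
  -- the lower bound: `k ≤ λ(X) = λ(fE)` once `fE ≠ 0`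
  have hkfE : fE ≠ 0 → k ≤ lam fE := fun hfE0 ↦ by
    rw [lam_generator_eq_lambdaInvariant D.X hX hfE0 hchar]
    exact halg κ γ hκ hγ D hX
  -- how the analytic certificates at `G = u · (h · fE)` finish
  have finish : ∀ (u h g : IwasawaAlgebra p) (e : ℕ) (L : PowerSeries ℚ_[p]), u ≠ 0 → lam u = e →
      h * fE = g → iwasawaToPowerSeries p (u * (h * fE)) = PowerSeries.C ((ϖ : ℚ) : ℚ_[p]) * L →
      (∃ k' : ℕ, (p : ℝ) ^ (-(((0 : ℕ) : ℤ) + 1)) <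
        ‖PowerSeries.coeff k' (PowerSeries.C ((ϖ : ℚ) : ℚ_[p]) * L)‖) →
      lam (u * (h * fE)) = n → n ≤ k + e → IsUnit h := by
    intro u h g e L hu0 hlu hgh hG hμ hlG hnk
    obtain ⟨k', hk'⟩ := hμ
    have hL0 : PowerSeries.C ((ϖ : ℚ) : ℚ_[p]) * L ≠ 0 := ne_zero_of_lt_norm_coeff hk'
    have hG0 : u * (h * fE) ≠ 0 := by
      intro h0; apply hL0; rw [← hG, h0, map_zero]
    have hh0 : h ≠ 0 := fun h0 ↦ hG0 (by rw [h0, zero_mul, mul_zero])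
    have hfE0 : fE ≠ 0 := fun h0 ↦ hG0 (by rw [h0, mul_zero, mul_zero])
    rw [← hG] at hk'
    have hμG : mu (u * (h * fE)) = 0 := Nat.le_zero.mp (mu_le_of_lt_norm_coeff hk')
    exact (isUnit_of_lam_mul_mul_eq_of_ge hu0 hh0 hfE0 hlu hμG hlG (hkfE hfE0) hnk).1
  refine ⟨hX, fE, hchar, fun hsplit L hL => ?_, fun hns L hL => ?_⟩
  · -- SPLIT `p`: `ι(T · g) = ϖ · L`, `g = h · fE`, `λ(T·h·fE) = n ≤ k + 1`
    obtain ⟨g, hgmem, hιg⟩ := hKs hsplit L hL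
    have hgmem' : g ∈ Ideal.span {fE} := by rw [← hchar]; exact hgmem
    obtain ⟨h, hgh⟩ := Ideal.mem_span_singleton'.mp hgmem'
    have hG : iwasawaToPowerSeries p (PowerSeries.X * (h * fE)) =
        PowerSeries.C ((ϖ : ℚ) : ℚ_[p]) * L := by rw [hgh]; exact hιg
    have hlG : lam (PowerSeries.X * (h * fE)) = n :=
      hlam f hf ϖ hϖ L (fun _ ↦ hL) (fun hns ↦ absurd hsplit hns) _ hG
    have hunit : IsUnit h := finish PowerSeries.X h g 1 L PowerSeries.X_ne_zero lam_X hgh hG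
      (hμ0 f hf ϖ hϖ L (fun _ ↦ hL) (fun hns ↦ absurd hsplit hns)) hlG (hkS hsplit)
    refine ⟨hunit.unit, ?_⟩
    rw [IsUnit.unit_spec, show (PowerSeries.X : IwasawaAlgebra p) * fE * h = PowerSeries.X * g by
      rw [← hgh]; ring]
    exact hιg
  · -- NON-SPLIT `p`: `ι(g) = ϖ · L`, `g = h · fE`, `λ(1·h·fE) = n ≤ k`
    obtain ⟨g, hgmem, hιg⟩ := hKns hns L hL
    have hgmem' : g ∈ Ideal.span {fE} := by rw [← hchar]; exact hgmem
    obtain ⟨h, hgh⟩ := Ideal.mem_span_singleton'.mp hgmem'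
    have hG : iwasawaToPowerSeries p (1 * (h * fE)) = PowerSeries.C ((ϖ : ℚ) : ℚ_[p]) * L := by
      rw [one_mul, hgh]; exact hιg
    have hlG : lam (1 * (h * fE)) = n :=
      hlam f hf ϖ hϖ L (fun hsplit ↦ absurd hsplit hns) (fun _ ↦ hL) _ hG
    have hunit : IsUnit h := finish 1 h g 0 L one_ne_zero (lam_eq_zero_of_isUnit isUnit_one) hgh hG
      (hμ0 f hf ϖ hϖ L (fun hsplit ↦ absurd hsplit hns) (fun _ ↦ hL)) hlG
      (by simpa using hkN hns)
    refine ⟨hunit.unit, ?_⟩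
    rw [IsUnit.unit_spec, show fE * h = g by rw [← hgh]; ring]
    exact hιg

/-- **Route T at an odd multiplicative Eisenstein prime, WITH PARITY (analytic rank `≤ 1`).** As
`mazurMainConjectureAt_of_algebraicLambdaGE`, with the weaker bounds `n ≤ k + 1` (non-split) /
`n ≤ k + 2` (split) and the parity of the datum: `n + r_an` even at a non-split prime, odd at a split
prime (`λ_an ≡ r_an + e (mod 2)`). Additional PUBLISHED named facts: Greenberg 1999 Prop. 3.10
(`h310`: `corank Sel_{p^∞}(E/ℚ) ≡ λ(X) (mod 2)`, good ordinary OR multiplicative `p`, `p` odd) and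
Gross–Zagier–Kolyvagin (`hGZK`: rank `= r_an`, `Ш` finite, so the corank is `r_an`). Then
`λ(h) = n − e − λ(f_E) ≤ 1` is even, hence `0`. [cite: GreenbergLNM1716, Prop. 3.10, Cor. 5.6 (proof, p. 136), §5 p. 183]
[cite: Wuthrich2014, Thm. 16 and §5 (p. 397)] -/
theorem mazurMainConjectureAt_of_algebraicLambdaGE_of_parity
    (hWu : thm16_charIdeal_dvd_multiplicative_of_reducible)
    (h310 : prop310_selmerCorank_mod_two_eq_lambdaInvariant)
    (hGZK : rank_eq_analyticRank_of_analyticRank_le_one)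
    (W : WeierstrassCurve ℚ) [W.IsElliptic] [W.IsGloballyMinimal] (p : ℕ) [Fact p.Prime]
    (hp2 : p ≠ 2) (hmult : W.HasMultiplicativeReductionAtPrime p)
    (hred : ¬ W.HasIrreducibleModPGaloisRep p) (hr : W.analyticRank ≤ 1) {n k : ℕ}
    (hμ0 : AnalyticMuLE W p 0) (hlam : AnalyticLambdaEq W p n) (halg : AlgebraicLambdaGE W p k)
    (hkN : ¬ W.HasSplitMultiplicativeReductionAtPrime p → n ≤ k + 1 ∧ Even (n + W.analyticRank))
    (hkS : W.HasSplitMultiplicativeReductionAtPrime p → n ≤ k + 2 ∧ Odd (n + W.analyticRank)) :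
    X2.MazurMainConjectureAt W p := by
  intro κ γ hκ hγ hγ' N _ f hf D ϖ hϖ
  haveI : Module.Finite (IwasawaAlgebra p) D.X := D.module_finite_holds hγ
  -- Wuthrich Thm. 16 at this datum; a generator `fE` of the characteristic ideal
  obtain ⟨hX, hKns, hKs⟩ := hWu W p hp2 hmult hred hκ hγ hγ' hf D ϖ hϖ
  haveI : (Literature.NumberTheory.EllipticCurves.Module.charIdeal (IwasawaAlgebra p) D.X).IsPrincipal :=
    charIdeal_isPrincipal_holds p D.X
  obtain ⟨fE, hfE⟩ := Submodule.IsPrincipal.principal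
    (Literature.NumberTheory.EllipticCurves.Module.charIdeal (IwasawaAlgebra p) D.X)
  have hchar : D.charIdeal = Ideal.span {fE} := hfE
  -- Gross–Zagier–Kolyvagin: `Ш` finite, `corank Sel_{p^∞}(E/ℚ) = rank E(ℚ) = r_an`
  obtain ⟨hrank, hfinsha⟩ := hGZK W hr
  haveI : Finite W.sha := hfinsha
  have hfinp : Finite (AddCommGroup.primaryComponent W.sha p) := inferInstance
  have hcork : W.selmerCorank p = W.analyticRank := by
    rw [selmerCorank_eq_mordellWeilRank_of_finite_shaPrimary W p hfinp, hrank]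
  -- the lower bound and the parity of `λ(fE) = λ(X)` (Prop. 3.10)
  have hkfE : fE ≠ 0 → k ≤ lam fE ∧ lam fE % 2 = W.analyticRank % 2 := fun hfE0 ↦ by
    rw [lam_generator_eq_lambdaInvariant D.X hX hfE0 hchar, ← hcork]
    exact ⟨halg κ γ hκ hγ D hX, (h310 W p hp2 κ γ hκ hγ D hX).symm⟩
  -- how the analytic certificates at `G = u · (h · fE)` finish
  have finish : ∀ (u h g : IwasawaAlgebra p) (e : ℕ) (L : PowerSeries ℚ_[p]), u ≠ 0 → lam u = e →
      h * fE = g → iwasawaToPowerSeries p (u * (h * fE)) = PowerSeries.C ((ϖ : ℚ) : ℚ_[p]) * L →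
      (∃ k' : ℕ, (p : ℝ) ^ (-(((0 : ℕ) : ℤ) + 1)) <
        ‖PowerSeries.coeff k' (PowerSeries.C ((ϖ : ℚ) : ℚ_[p]) * L)‖) →
      lam (u * (h * fE)) = n → n ≤ k + e + 1 → Even (n + e + W.analyticRank) → IsUnit h := by
    intro u h g e L hu0 hlu hgh hG hμ hlG hnk hpar
    obtain ⟨k', hk'⟩ := hμ
    have hL0 : PowerSeries.C ((ϖ : ℚ) : ℚ_[p]) * L ≠ 0 := ne_zero_of_lt_norm_coeff hk'
    have hG0 : u * (h * fE) ≠ 0 := by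
      intro h0; apply hL0; rw [← hG, h0, map_zero]
    have hh0 : h ≠ 0 := fun h0 ↦ hG0 (by rw [h0, zero_mul, mul_zero])
    have hfE0 : fE ≠ 0 := fun h0 ↦ hG0 (by rw [h0, mul_zero, mul_zero])
    rw [← hG] at hk'
    have hμG : mu (u * (h * fE)) = 0 := Nat.le_zero.mp (mu_le_of_lt_norm_coeff hk')
    obtain ⟨hk, hmod⟩ := hkfE hfE0
    have hpar' : Even (n + e + lam fE) := by
      rcases Nat.even_or_odd (lam fE) with hev | hod
      · rw [Nat.even_iff] at hev ⊢
        rcases hpar with ⟨j, hj⟩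
        omega
      · rw [Nat.odd_iff] at hod
        rw [Nat.even_iff] at ⊢
        rcases hpar with ⟨j, hj⟩
        omega
    exact (isUnit_of_lam_mul_mul_eq_of_ge_of_even hu0 hh0 hfE0 hlu hμG hlG hk hnk hpar').1
  refine ⟨hX, fE, hchar, fun hsplit L hL => ?_, fun hns L hL => ?_⟩
  · -- SPLIT `p`: `λ(T·h·fE) = n ≤ k + 2`, `n + r_an` odd
    obtain ⟨hk2, hodd⟩ := hkS hsplit
    obtain ⟨g, hgmem, hιg⟩ := hKs hsplit L hL
    have hgmem' : g ∈ Ideal.span {fE} := by rw [← hchar]; exact hgmem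
    obtain ⟨h, hgh⟩ := Ideal.mem_span_singleton'.mp hgmem'
    have hG : iwasawaToPowerSeries p (PowerSeries.X * (h * fE)) =
        PowerSeries.C ((ϖ : ℚ) : ℚ_[p]) * L := by rw [hgh]; exact hιg
    have hlG : lam (PowerSeries.X * (h * fE)) = n :=
      hlam f hf ϖ hϖ L (fun _ ↦ hL) (fun hns ↦ absurd hsplit hns) _ hG
    have hpar : Even (n + 1 + W.analyticRank) := by
      rw [add_right_comm]; exact hodd.add_one
    have hunit : IsUnit h := finish PowerSeries.X h g 1 L PowerSeries.X_ne_zero lam_X hgh hG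
      (hμ0 f hf ϖ hϖ L (fun _ ↦ hL) (fun hns ↦ absurd hsplit hns)) hlG (by omega) hpar
    refine ⟨hunit.unit, ?_⟩
    rw [IsUnit.unit_spec, show (PowerSeries.X : IwasawaAlgebra p) * fE * h = PowerSeries.X * g by
      rw [← hgh]; ring]
    exact hιg
  · -- NON-SPLIT `p`: `λ(1·h·fE) = n ≤ k + 1`, `n + r_an` even
    obtain ⟨hk1, heven⟩ := hkN hns
    obtain ⟨g, hgmem, hιg⟩ := hKns hns L hL
    have hgmem' : g ∈ Ideal.span {fE} := by rw [← hchar]; exact hgmem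
    obtain ⟨h, hgh⟩ := Ideal.mem_span_singleton'.mp hgmem'
    have hG : iwasawaToPowerSeries p (1 * (h * fE)) = PowerSeries.C ((ϖ : ℚ) : ℚ_[p]) * L := by
      rw [one_mul, hgh]; exact hιg
    have hlG : lam (1 * (h * fE)) = n :=
      hlam f hf ϖ hϖ L (fun hsplit ↦ absurd hsplit hns) (fun _ ↦ hL) _ hG
    have hpar : Even (n + 0 + W.analyticRank) := by rw [add_zero]; exact heven
    have hunit : IsUnit h := finish 1 h g 0 L one_ne_zero (lam_eq_zero_of_isUnit isUnit_one) hgh hG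
      (hμ0 f hf ϖ hϖ L (fun hsplit ↦ absurd hsplit hns) (fun _ ↦ hL)) hlG (by omega) hpar
    refine ⟨hunit.unit, ?_⟩
    rw [IsUnit.unit_spec, show fE * h = g by rw [← hgh]; ring]
    exact hιg

/-! ### Consistency: a certified lower bound never exceeds `λ_an − e` -/

/-- **Consistency (Kato–Wuthrich direction, `λ_alg + e ≤ λ_an` at `p ‖ N`).** If
`AlgebraicLambdaGE W p k`, `AnalyticLambdaEq W p n` and `AnalyticMuLE W p m` (any `m`; it makes
`ϖ·L ≠ 0`) at an odd multiplicative Eisenstein prime, then `k ≤ n` at a non-split prime and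
`k + 1 ≤ n` at a split prime: the data exist (modularity `hmod`; THE multiplicative `p`-adic
`L`-function by the tree theorems `exists_isSplitMultPAdicLFunctionOf` /
`exists_isMultPAdicLFunctionOf_neg_one_of_nonsplit`; the cyclotomic `κ, γ`; a dual datum) and
`ϖ·L = ι(T^e·h·f_E)` gives `n = e + λ(h) + λ(f_E) ≥ e + λ(X) ≥ e + k`. The kernel form of the
census's falsification test. [cite: Wuthrich2014, Thm. 16 (p. 397)]
[cite: MazurTateTeitelbaum1986Invent, §I.10 Prop. and §I.14 (14.3)] -/
theorem add_le_of_algebraicLambdaGE_of_analyticLambdaEq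
    (hWu : thm16_charIdeal_dvd_multiplicative_of_reducible)
    (hmod : nonempty_modularParametrizationData)
    (W : WeierstrassCurve ℚ) [W.IsElliptic] [W.IsGloballyMinimal] (p : ℕ) [Fact p.Prime]
    (hp2 : p ≠ 2) (hmult : W.HasMultiplicativeReductionAtPrime p)
    (hred : ¬ W.HasIrreducibleModPGaloisRep p) {n k m : ℕ}
    (hμ : AnalyticMuLE W p m) (hlam : AnalyticLambdaEq W p n) (halg : AlgebraicLambdaGE W p k) :
    (¬ W.HasSplitMultiplicativeReductionAtPrime p → k ≤ n) ∧
      (W.HasSplitMultiplicativeReductionAtPrime p → k + 1 ≤ n) := by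
  haveI : NeZero (W.conductorNorm ℤ) := ⟨(W.conductorNorm_pos_holds).ne'⟩
  obtain ⟨Dm⟩ := hmod W
  have hf : IsNewformOf W Dm.f := Dm.isNewformOf
  obtain ⟨ϖ, -, hϖeq, -⟩ := Dm.exists_rat_mul_realPeriodRat_eq_plusPeriod
  obtain ⟨κ, hκ, γ, hγ, hγ'⟩ := exists_isCyclotomic_isTopGenerator_isCyclotomicVariable_holds p
  obtain ⟨D⟩ := W.nonempty_selmerDualData_holds κ γ hγ
  haveI : Module.Finite (IwasawaAlgebra p) D.X := D.module_finite_holds hγ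
  obtain ⟨hXt, hKns, hKs⟩ := hWu W p hp2 hmult hred hκ hγ hγ' hf D ϖ hϖeq
  obtain ⟨fE, hchar⟩ := (charIdeal_isPrincipal_holds p D.X).principal
  have hchar' : D.charIdeal = Ideal.span {fE} := hchar
  -- the count at `G = u · (h · fE)`, `λ(u) = e`
  have count : ∀ (u h : IwasawaAlgebra p) (e : ℕ) (L : PowerSeries ℚ_[p]), u ≠ 0 → lam u = e →
      iwasawaToPowerSeries p (u * (h * fE)) = PowerSeries.C ((ϖ : ℚ) : ℚ_[p]) * L →
      (∃ k' : ℕ, (p : ℝ) ^ (-((m : ℤ) + 1)) <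
        ‖PowerSeries.coeff k' (PowerSeries.C ((ϖ : ℚ) : ℚ_[p]) * L)‖) →
      lam (u * (h * fE)) = n → k + e ≤ n := by
    intro u h e L hu0 hlu hG hμ' hlG
    obtain ⟨k', hk'⟩ := hμ'
    have hL0 : PowerSeries.C ((ϖ : ℚ) : ℚ_[p]) * L ≠ 0 := ne_zero_of_lt_norm_coeff hk'
    have hG0 : u * (h * fE) ≠ 0 := by
      intro h0; apply hL0; rw [← hG, h0, map_zero]
    have hh0 : h ≠ 0 := fun h0 ↦ hG0 (by rw [h0, zero_mul, mul_zero])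
    have hfE0 : fE ≠ 0 := fun h0 ↦ hG0 (by rw [h0, mul_zero, mul_zero])
    have h2 : lam fE = lambdaInvariant p D.X := lam_generator_eq_lambdaInvariant D.X hXt hfE0 hchar'
    have h3 : k ≤ lambdaInvariant p D.X := halg κ γ hκ hγ D hXt
    rw [lam_mul hu0 (mul_ne_zero hh0 hfE0), lam_mul hh0 hfE0, hlu] at hlG
    omega
  constructor
  · intro hns
    obtain ⟨L, hL⟩ := exists_isMultPAdicLFunctionOf_neg_one_of_nonsplit hf hmult hns
    obtain ⟨g, hgmem, hιg⟩ := hKns hns L hL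
    have hgmem' : g ∈ Ideal.span {fE} := by rw [← hchar']; exact hgmem
    obtain ⟨h, hgh⟩ := Ideal.mem_span_singleton'.mp hgmem'
    have hG : iwasawaToPowerSeries p (1 * (h * fE)) = PowerSeries.C ((ϖ : ℚ) : ℚ_[p]) * L := by
      rw [one_mul, hgh]; exact hιg
    have hlG : lam (1 * (h * fE)) = n :=
      hlam Dm.f hf ϖ hϖeq L (fun hsplit ↦ absurd hsplit hns) (fun _ ↦ hL) _ hG
    have := count 1 h 0 L one_ne_zero (lam_eq_zero_of_isUnit isUnit_one) hG
      (hμ Dm.f hf ϖ hϖeq L (fun hsplit ↦ absurd hsplit hns) (fun _ ↦ hL)) hlG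
    omega
  · intro hsplit
    obtain ⟨L, hL⟩ := exists_isSplitMultPAdicLFunctionOf hsplit hf
    obtain ⟨g, hgmem, hιg⟩ := hKs hsplit L hL
    have hgmem' : g ∈ Ideal.span {fE} := by rw [← hchar']; exact hgmem
    obtain ⟨h, hgh⟩ := Ideal.mem_span_singleton'.mp hgmem'
    have hG : iwasawaToPowerSeries p (PowerSeries.X * (h * fE)) =
        PowerSeries.C ((ϖ : ℚ) : ℚ_[p]) * L := by rw [hgh]; exact hιg
    have hlG : lam (PowerSeries.X * (h * fE)) = n :=
      hlam Dm.f hf ϖ hϖeq L (fun _ ↦ hL) (fun hns ↦ absurd hsplit hns) _ hG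
    exact count PowerSeries.X h 1 L PowerSeries.X_ne_zero lam_X hG
      (hμ Dm.f hf ϖ hϖeq L (fun _ ↦ hL) (fun hns ↦ absurd hsplit hns)) hlG

end RouteT

end Summit.BirchSwinnertonDyer.Rank1Residual.X2

end
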